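import Mathlib.MeasureTheory.Measure.Hausdorff
import Summits.QuantumFields.YangMills.Theorems.EquipartitionCriticalityFreeEnergyLogCoefficientStubExpChartPackage
import HarnessLib

/-!
# Crux `FemtoCurvatureTwoPointC` (stmt-QuantumFields-16204), line `Sketch`:
# product Haar measure scales like a `D`-dimensional Hausdorff measure (`stub_haarCoLipschitz`)

For a compact group `G` with a faithful continuous unitary representation `ρ : G →* M_N(ℂ)` and a
finite index type `ι`, read configurations `u ∈ G^ι` as matrix tuples `θ(u) = (ρ(u_e))_e` in
`M = (M_N(ℂ))^ι` with the sup-of-Frobenius norm.  We show (`stub_haarCoLipschitz`, taken verbatim as a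
hypothesis by the lead's `stub_sublevelDoubling`): there are `D ≥ 0` and `C` such that whenever `F`
maps `X ⊆ G^ι` into `Y` and `‖θu − θv‖ ≤ K ‖θ(Fu) − θ(Fv)‖` on `X`, then
`Haar^ι(X) ≤ C K^D Haar^ι(Y)`.

Proof.  `D = #ι · dim 𝔤_ρ` (`dimE ρ`, the dimension of the exponential chart `expChart ρ` of the
tree) and `C = 1`.  The measure `ν(A) = μH[D](θ(A))` on `G^ι` (`θ` is a closed embedding) is left
invariant, because left multiplication by the unitary tuple `ρ^ι(u)` is an isometry of `M`
(`Matrix.frobenius_norm_unitaryGroup_mul`, `Isometry.hausdorffMeasure_image`).  It is finite: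
`G^ι` is covered by finitely many left translates of the neighbourhood `{‖ρ(v_e) − 1‖ < r₁ ∀ e}`,
which lies in the image of a ball of `(ℝ^{dim 𝔤})^ι` under the `1`-Lipschitz map `θ ∘ expChart^ι`
(`norm_rho_expChart_sub_le`, von Neumann's local surjectivity `exists_chartRadius`), and balls of
`(ℝ^d)^ι` have finite positive `μH[#ι d]`-measure (`hausdorffMeasure_pi_real` transported along a
continuous linear equivalence with `ℝ^{ι × d}`).  It is non-zero: on a small ball the same map is
co-Lipschitz (`le_norm_rho_expChart_sub`), so its image has positive `μH[D]`-measure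
(`AntilipschitzWith.le_hausdorffMeasure_image`).  Haar uniqueness on the compact group `G^ι`
(`Measure.isMulInvariant_eq_smul_of_compactSpace`) gives `Haar^ι = c · ν` with `0 < c < ∞`, and for a
`K`-co-Lipschitz `F` the map `θu ↦ θ(Fu)` is `K`-antilipschitz on `θ(X)`, whence
`μH[D](θX) ≤ K^D μH[D](θ(FX)) ≤ K^D μH[D](θY)`.  The Borel structure on `M` is chosen inside the
proof.  Mathlib + the tree's exponential chart files; no named facts.
-/

set_option autoImplicit false

noncomputable section

open scoped Matrix Matrix.Norms.Frobenius ENNReal NNReal Topology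
open MeasureTheory Measure Set Metric Function
open Literature.MathematicalPhysics.QuantumFieldTheory
open Summit.QuantumFields.YangMills.Theorems.FreeEnergyLogCoefficient

namespace Summit.QuantumFields.YangMills.Theorems.FemtoCurvatureTwoPointC

namespace HaarCoLipschitz

/-! ## Hausdorff measure of balls in `(ℝ^d)^ι` -/

/-- Closed balls of positive radius in `(ℝ^d)^ι` (sup-of-Euclidean norm) have finite positive
`#ι·d`-dimensional Hausdorff measure: transport of `μH[#(ι × d)] = vol` on `ℝ^{ι × d}`
(`hausdorffMeasure_pi_real`) along a continuous linear equivalence, which is Lipschitz in both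
directions. -/
theorem hausdorffMeasure_closedBall_pos_and_lt_top (ι : Type*) [Fintype ι] (d : ℕ) {r : ℝ}
    (hr : 0 < r) :
    0 < μH[(Fintype.card (ι × Fin d) : ℝ)] (closedBall (0 : ι → EuclideanSpace ℝ (Fin d)) r) ∧
      μH[(Fintype.card (ι × Fin d) : ℝ)] (closedBall (0 : ι → EuclideanSpace ℝ (Fin d)) r) < ∞ := by
  have hD : (0 : ℝ) ≤ (Fintype.card (ι × Fin d) : ℝ) := Nat.cast_nonneg _
  have hfin : Module.finrank ℝ (ι → EuclideanSpace ℝ (Fin d)) =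
      Module.finrank ℝ (ι × Fin d → ℝ) := by
    rw [Module.finrank_pi_fintype, Module.finrank_fintype_fun_eq_card, Fintype.card_prod,
      Fintype.card_fin]
    simp
  let e : (ι → EuclideanSpace ℝ (Fin d)) ≃L[ℝ] (ι × Fin d → ℝ) :=
    ContinuousLinearEquiv.ofFinrankEq hfin
  have hvol : (μH[(Fintype.card (ι × Fin d) : ℝ)] : Measure (ι × Fin d → ℝ)) = volume :=
    hausdorffMeasure_pi_real
  constructor
  · have h1 := e.lipschitz.hausdorffMeasure_image_le hD
      (closedBall (0 : ι → EuclideanSpace ℝ (Fin d)) r)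
    have h2 : 0 < μH[(Fintype.card (ι × Fin d) : ℝ)]
        (e '' closedBall (0 : ι → EuclideanSpace ℝ (Fin d)) r) := by
      rw [hvol]
      refine lt_of_lt_of_le ?_ (measure_mono (image_mono ball_subset_closedBall))
      exact (e.isOpenMap _ isOpen_ball).measure_pos volume ⟨e 0, 0, mem_ball_self hr, rfl⟩
    have h3 := h2.trans_le h1
    refine pos_iff_ne_zero.2 fun h => ?_
    rw [h, mul_zero] at h3
    exact lt_irrefl _ h3
  · have h1 := e.antilipschitz.le_hausdorffMeasure_image hD
      (closedBall (0 : ι → EuclideanSpace ℝ (Fin d)) r)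
    refine lt_of_le_of_lt h1
      (ENNReal.mul_lt_top (ENNReal.rpow_lt_top_of_nonneg hD ENNReal.coe_ne_top) ?_)
    rw [hvol]
    exact (e.lipschitz.isBounded_image isBounded_closedBall).measure_lt_top

/-! ## The matrix picture of configurations -/

section MatrixPicture

variable {N : ℕ} {G : Type*} [Group G] (ρ : G →* Matrix (Fin N) (Fin N) ℂ) {ι : Type*}

/-! The coordinatewise matrix image `θ(u) = (ρ(u_e))_e ∈ (M_N(ℂ))^ι` of a configuration `u ∈ G^ι` is
Mathlib's `ρ.compLeft ι : (ι → G) →* (ι → M_N(ℂ))`. -/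

/-- `θ = ρ^ι` is injective for faithful `ρ`. -/
theorem compLeft_injective (hinj : Injective ρ) : Injective (ρ.compLeft ι) := by
  intro u v h
  funext e
  have h' := congr_fun h e
  simp only [MonoidHom.compLeft_apply, Function.comp_apply] at h'
  exact hinj h'

/-- `θ = ρ^ι` is continuous for continuous `ρ`. -/
theorem continuous_compLeft [TopologicalSpace G] (hρ : Continuous ρ) :
    Continuous (ρ.compLeft ι) := by
  refine continuous_pi fun e => ?_
  simp only [MonoidHom.compLeft_apply, Function.comp_apply]
  exact hρ.comp (continuous_apply e)

/-- Left multiplication by a unitary tuple `ρ^ι(u)` is an isometry of `(M_N(ℂ))^ι` (unitary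
invariance of the Frobenius norm). -/
theorem isometry_mulLeft [Fintype ι] (hU : ∀ g, ρ g ∈ Matrix.unitaryGroup (Fin N) ℂ)
    (u : ι → G) :
    Isometry fun m : ι → Matrix (Fin N) (Fin N) ℂ => fun e => ρ (u e) * m e := by
  refine Isometry.of_dist_eq fun m m' => ?_
  rw [dist_eq_norm, dist_eq_norm]
  have key : ∀ e, ‖ρ (u e) * m e - ρ (u e) * m' e‖ = ‖m e - m' e‖ := fun e => by
    rw [← Matrix.mul_sub]
    exact Matrix.frobenius_norm_unitaryGroup_mul ⟨ρ (u e), hU (u e)⟩ _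
  refine le_antisymm ((pi_norm_le_iff_of_nonneg (norm_nonneg _)).2 fun e => ?_)
    ((pi_norm_le_iff_of_nonneg (norm_nonneg _)).2 fun e => ?_)
  · rw [Pi.sub_apply, key e]
    exact norm_le_pi_norm (m - m') e
  · rw [Pi.sub_apply, ← key e]
    exact norm_le_pi_norm ((fun e => ρ (u e) * m e) - fun e => ρ (u e) * m' e) e

/-- `θ((u·)⁻¹(A)) = ρ^ι(u⁻¹) · θ(A)`. -/
theorem compLeft_image_preimage_mul (u : ι → G) (A : Set (ι → G)) :
    ρ.compLeft ι '' ((fun v => u * v) ⁻¹' A) =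
      (fun m : ι → Matrix (Fin N) (Fin N) ℂ => fun e => ρ (u⁻¹ e) * m e) '' (ρ.compLeft ι '' A) := by
  ext m
  constructor
  · rintro ⟨v, hv, rfl⟩
    refine ⟨ρ.compLeft ι (u * v), ⟨u * v, hv, rfl⟩, funext fun e => ?_⟩
    simp only [MonoidHom.compLeft_apply, Function.comp_apply, Pi.mul_apply, Pi.inv_apply, map_mul,
      ← mul_assoc]
    rw [← map_mul, inv_mul_cancel, map_one, one_mul]
  · rintro ⟨_, ⟨w, hw, rfl⟩, rfl⟩
    refine ⟨u⁻¹ * w, ?_, funext fun e => ?_⟩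
    · show u * (u⁻¹ * w) ∈ A
      rwa [mul_inv_cancel_left]
    · simp only [MonoidHom.compLeft_apply, Function.comp_apply, Pi.mul_apply, Pi.inv_apply, map_mul]

-- The Borel structure on matrix tuples is taken as a hypothesis, with the topology written along
-- the path `EMetricSpace → UniformSpace → TopologicalSpace` used by `μH[d]` (the product topology and
-- the sup-of-Frobenius metric topology agree definitionally, but not reducibly).
variable [Fintype ι] [MeasurableSpace (ι → Matrix (Fin N) (Fin N) ℂ)]
  [hB : @BorelSpace (ι → Matrix (Fin N) (Fin N) ℂ) (UniformSpace.toTopologicalSpace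
    (self := PseudoEMetricSpace.toUniformSpace (self := EMetricSpace.toPseudoEMetricSpace))) ‹_›]

/-- Left invariance of `A ↦ μH[d](θ(A))`. -/
theorem hausdorffMeasure_compLeft_preimage_mul (hU : ∀ g, ρ g ∈ Matrix.unitaryGroup (Fin N) ℂ)
    {d : ℝ} (hd : 0 ≤ d) (u : ι → G) (A : Set (ι → G)) :
    μH[d] (ρ.compLeft ι '' ((fun v => u * v) ⁻¹' A)) = μH[d] (ρ.compLeft ι '' A) := by
  rw [compLeft_image_preimage_mul, (isometry_mulLeft ρ hU u⁻¹).hausdorffMeasure_image (Or.inl hd)]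

/-- **Co-Lipschitz maps and Hausdorff measure.** If `F` maps `X` into `Y` and
`‖θu − θv‖ ≤ K ‖θ(Fu) − θ(Fv)‖` on `X`, then `μH[d](θX) ≤ K^d μH[d](θY)`: the map `θu ↦ θ(Fu)` is
`K`-antilipschitz on `θ(X)` (`AntilipschitzWith.le_hausdorffMeasure_image`). -/
theorem hausdorffMeasure_compLeft_le_of_coLipschitz (hinj : Injective ρ) {d : ℝ} (hd : 0 ≤ d)
    {K : ℝ≥0} {X Y : Set (ι → G)} {F : (ι → G) → ι → G} (hF : MapsTo F X Y)
    (hco : ∀ u ∈ X, ∀ v ∈ X,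
      ‖(fun e => ρ (u e) - ρ (v e))‖ ≤ K * ‖(fun e => ρ (F u e) - ρ (F v e))‖) :
    μH[d] (ρ.compLeft ι '' X) ≤ (K : ℝ≥0∞) ^ d * μH[d] (ρ.compLeft ι '' Y) := by
  have hθ := compLeft_injective ρ (ι := ι) hinj
  let Ψ : ↥(ρ.compLeft ι '' X) → ι → Matrix (Fin N) (Fin N) ℂ := fun m =>
    ρ.compLeft ι (F (invFun (ρ.compLeft ι) m.1))
  have hΨ : ∀ {u : ι → G} (hu : u ∈ X), Ψ ⟨ρ.compLeft ι u, u, hu, rfl⟩ = ρ.compLeft ι (F u) :=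
    fun {u} _ => by
      show ρ.compLeft ι (F (invFun (ρ.compLeft ι) (ρ.compLeft ι u))) = ρ.compLeft ι (F u)
      rw [leftInverse_invFun hθ u]
  have hanti : AntilipschitzWith K Ψ := by
    refine AntilipschitzWith.of_le_mul_dist ?_
    rintro ⟨_, u, hu, rfl⟩ ⟨_, v, hv, rfl⟩
    rw [hΨ hu, hΨ hv, Subtype.dist_eq, dist_eq_norm, dist_eq_norm]
    exact hco u hu v hv
  have h1 : μH[d] (ρ.compLeft ι '' X) = μH[d] (univ : Set ↥(ρ.compLeft ι '' X)) := by
    rw [← (isometry_subtype_coe (s := ρ.compLeft ι '' X)).hausdorffMeasure_image (Or.inl hd),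
      image_univ, Subtype.range_coe]
  have h2 : Ψ '' univ ⊆ ρ.compLeft ι '' Y := by
    rintro _ ⟨⟨_, u, hu, rfl⟩, -, rfl⟩
    exact ⟨F u, hF hu, (hΨ hu).symm⟩
  calc μH[d] (ρ.compLeft ι '' X) = μH[d] (univ : Set ↥(ρ.compLeft ι '' X)) := h1
    _ ≤ (K : ℝ≥0∞) ^ d * μH[d] (Ψ '' univ) := hanti.le_hausdorffMeasure_image hd _
    _ ≤ (K : ℝ≥0∞) ^ d * μH[d] (ρ.compLeft ι '' Y) := by gcongr

end MatrixPicture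

/-! ## The coordinatewise exponential chart in the matrix picture -/

section Chart

variable {N : ℕ} {G : Type*} [Group G] [TopologicalSpace G] [CompactSpace G]
  (ρ : G →* Matrix (Fin N) (Fin N) ℂ) {ι : Type*} [Fintype ι]

/-! The matrix picture of the coordinatewise exponential chart is
`Θ(a) = θ(expChart ρ ∘ a) = (ρ(expChart ρ (a_e)))_e`, `a ∈ (ℝ^{dimE ρ})^ι`. -/

/-- `Θ` is `1`-Lipschitz (`norm_rho_expChart_sub_le` coordinatewise). -/
theorem lipschitz_compLeft_expChart (hρ : Continuous ρ) :
    LipschitzWith 1 fun a : ι → EuclideanSpace ℝ (Fin (dimE ρ)) => ρ.compLeft ι (expChart ρ ∘ a) :=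
  LipschitzWith.mk_one fun a b => by
    rw [dist_eq_norm, dist_eq_norm]
    refine (pi_norm_le_iff_of_nonneg (norm_nonneg _)).2 fun e => ?_
    simp only [MonoidHom.compLeft_apply, Pi.sub_apply, Function.comp_apply]
    exact (norm_rho_expChart_sub_le ρ hρ (a e) (b e)).trans (norm_le_pi_norm (a - b) e)

/-- `Θ` is co-Lipschitz on the ball of radius `r` with `e^r < 2` (`le_norm_rho_expChart_sub`
coordinatewise). -/
theorem antilipschitz_restrict_compLeft_expChart (hρ : Continuous ρ) {r : ℝ} (hr : Real.exp r < 2) :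
    AntilipschitzWith (Real.toNNReal (2 - Real.exp r)⁻¹)
      ((closedBall (0 : ι → EuclideanSpace ℝ (Fin (dimE ρ))) r).restrict
        fun a => ρ.compLeft ι (expChart ρ ∘ a)) := by
  have hpos : 0 < 2 - Real.exp r := sub_pos.2 hr
  refine AntilipschitzWith.of_le_mul_dist fun a b => ?_
  rw [Real.coe_toNNReal _ (inv_nonneg.2 hpos.le), Subtype.dist_eq, dist_eq_norm, Set.restrict_apply,
    Set.restrict_apply, dist_eq_norm]
  have ha : ‖(a : ι → EuclideanSpace ℝ (Fin (dimE ρ)))‖ ≤ r := mem_closedBall_zero_iff.1 a.2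
  have hb : ‖(b : ι → EuclideanSpace ℝ (Fin (dimE ρ)))‖ ≤ r := mem_closedBall_zero_iff.1 b.2
  refine (pi_norm_le_iff_of_nonneg (mul_nonneg (inv_nonneg.2 hpos.le) (norm_nonneg _))).2
    fun e => ?_
  rw [← div_eq_inv_mul, le_div_iff₀' hpos, Pi.sub_apply]
  refine (le_norm_rho_expChart_sub ρ hρ ((norm_le_pi_norm _ e).trans ha)
    ((norm_le_pi_norm _ e).trans hb)).trans ?_
  simpa only [MonoidHom.compLeft_apply, Pi.sub_apply, Function.comp_apply] using
    norm_le_pi_norm (ρ.compLeft ι (expChart ρ ∘ (a : ι → EuclideanSpace ℝ (Fin (dimE ρ)))) -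
      ρ.compLeft ι (expChart ρ ∘ (b : ι → EuclideanSpace ℝ (Fin (dimE ρ))))) e

end Chart

/-! ## `μH[D](θ(G^ι)) ∈ (0, ∞)` and the comparison with product Haar measure -/

section Haar

variable {N : ℕ} {G : Type*} [Group G] [TopologicalSpace G] [IsTopologicalGroup G] [CompactSpace G]
  [MeasurableSpace G] [BorelSpace G] (ρ : G →* Matrix (Fin N) (Fin N) ℂ) {ι : Type*} [Fintype ι]
  [MeasurableSpace (ι → Matrix (Fin N) (Fin N) ℂ)]
  [hB : @BorelSpace (ι → Matrix (Fin N) (Fin N) ℂ) (UniformSpace.toTopologicalSpace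
    (self := PseudoEMetricSpace.toUniformSpace (self := EMetricSpace.toPseudoEMetricSpace))) ‹_›]

omit [IsTopologicalGroup G] [MeasurableSpace G] [BorelSpace G] in
/-- **Positivity**: `μH[D](θ(G^ι)) ≠ 0`, `D = #ι · dimE ρ` — the image of a small ball under the
co-Lipschitz `Θ` has positive measure. -/
theorem hausdorffMeasure_range_compLeft_ne_zero (hρ : Continuous ρ) :
    μH[(Fintype.card (ι × Fin (dimE ρ)) : ℝ)] (range (ρ.compLeft ι)) ≠ 0 := by
  have hD : (0 : ℝ) ≤ (Fintype.card (ι × Fin (dimE ρ)) : ℝ) := Nat.cast_nonneg _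
  have hexp : Real.exp (4 * (1 / 64 : ℝ)) < 2 :=
    lt_of_le_of_lt (exp_four_mul_le (by norm_num)) (by norm_num)
  have hsub : (fun a : ι → EuclideanSpace ℝ (Fin (dimE ρ)) => ρ.compLeft ι (expChart ρ ∘ a)) ''
      closedBall (0 : ι → EuclideanSpace ℝ (Fin (dimE ρ))) (4 * (1 / 64 : ℝ)) ⊆ range (ρ.compLeft ι) := by
    rintro _ ⟨a, -, rfl⟩
    exact ⟨expChart ρ ∘ a, rfl⟩
  intro h0
  have h1 :=
    (antilipschitz_restrict_compLeft_expChart ρ hρ hexp (ι := ι)).le_hausdorffMeasure_image hD univ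
  rw [image_univ, range_restrict, measure_mono_null hsub h0, mul_zero, nonpos_iff_eq_zero,
    ← (isometry_subtype_coe (s := closedBall (0 : ι → EuclideanSpace ℝ (Fin (dimE ρ)))
      (4 * (1 / 64 : ℝ)))).hausdorffMeasure_image (Or.inl hD), image_univ, Subtype.range_coe] at h1
  exact (hausdorffMeasure_closedBall_pos_and_lt_top ι (dimE ρ) (by norm_num)).1.ne' h1

omit [MeasurableSpace G] [BorelSpace G] in
/-- **Finiteness**: `μH[D](θ(G^ι)) < ∞` — `G^ι` is covered by finitely many left translates of a
neighbourhood of `1` contained in the image of a ball under the `1`-Lipschitz `Θ`, and left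
translates do not change `μH[D] ∘ θ`. -/
theorem hausdorffMeasure_range_compLeft_lt_top (hρ : Continuous ρ) (hinj : Injective ρ)
    (hU : ∀ g, ρ g ∈ Matrix.unitaryGroup (Fin N) ℂ) :
    μH[(Fintype.card (ι × Fin (dimE ρ)) : ℝ)] (range (ρ.compLeft ι)) < ∞ := by
  have hD : (0 : ℝ) ≤ (Fintype.card (ι × Fin (dimE ρ)) : ℝ) := Nat.cast_nonneg _
  obtain ⟨r₁, hr₁, -, hsurj⟩ := exists_chartRadius ρ hρ hinj hU
  set V : Set (ι → G) := Set.pi univ fun _ => {g : G | ‖ρ g - 1‖ < r₁}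
  have hVo : IsOpen V :=
    isOpen_set_pi finite_univ fun _ _ => isOpen_lt (continuous_norm_rho_sub ρ hρ 1) continuous_const
  have h1V : (1 : ι → G) ∈ V := mem_univ_pi.2 fun e => by simp [hr₁]
  obtain ⟨t, ht⟩ := compact_covered_by_mul_left_translates (K := (univ : Set (ι → G))) (V := V)
    isCompact_univ (by rw [hVo.interior_eq]; exact ⟨1, h1V⟩)
  have hVfin : μH[(Fintype.card (ι × Fin (dimE ρ)) : ℝ)] (ρ.compLeft ι '' V) < ∞ := by
    have hsub : ρ.compLeft ι '' V ⊆
        (fun a : ι → EuclideanSpace ℝ (Fin (dimE ρ)) => ρ.compLeft ι (expChart ρ ∘ a)) ''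
          closedBall (0 : ι → EuclideanSpace ℝ (Fin (dimE ρ))) (2 * r₁) := by
      rintro _ ⟨v, hv, rfl⟩
      have hex : ∀ e, ∃ a : EuclideanSpace ℝ (Fin (dimE ρ)), expChart ρ a = v e ∧ ‖a‖ ≤ 2 * r₁ :=
        fun e => by
          have hve : ‖ρ (v e) - 1‖ < r₁ := (mem_univ_pi.1 hv) e
          obtain ⟨a, ha, han⟩ := hsurj (v e) (by linarith)
          exact ⟨a, ha, han.trans (by linarith)⟩
      choose a ha han using hex
      refine ⟨a, mem_closedBall_zero_iff.2 ((pi_norm_le_iff_of_nonneg (by linarith)).2 han), ?_⟩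
      funext e
      simp [ha]
    refine lt_of_le_of_lt (measure_mono hsub) ?_
    refine lt_of_le_of_lt ((lipschitz_compLeft_expChart ρ hρ).hausdorffMeasure_image_le hD _) ?_
    rw [ENNReal.coe_one, ENNReal.one_rpow, one_mul]
    exact (hausdorffMeasure_closedBall_pos_and_lt_top ι (dimE ρ) (by linarith)).2
  have hcov : range (ρ.compLeft ι) ⊆ ⋃ g ∈ t, ρ.compLeft ι '' ((fun v => g * v) ⁻¹' V) := by
    rintro _ ⟨u, rfl⟩
    obtain ⟨g, hg, hu⟩ := mem_iUnion₂.1 (ht (mem_univ u))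
    exact mem_iUnion₂.2 ⟨g, hg, u, hu, rfl⟩
  refine lt_of_le_of_lt (measure_mono hcov) (lt_of_le_of_lt (measure_biUnion_finset_le t _) ?_)
  refine ENNReal.sum_lt_top.2 fun g _ => ?_
  rw [hausdorffMeasure_compLeft_preimage_mul ρ hU hD]
  exact hVfin

/-- **Product Haar measure is a multiple of `μH[D] ∘ θ`**: there is `c` with
`Haar^ι(A) = c · μH[D](θ(A))` for every `A ⊆ G^ι` (Haar uniqueness on the compact group `G^ι` for
the left-invariant, finite, non-zero measure `μH[D] ∘ θ`). -/
theorem exists_pi_haar_eq_mul_hausdorffMeasure (hρ : Continuous ρ) (hinj : Injective ρ)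
    (hU : ∀ g, ρ g ∈ Matrix.unitaryGroup (Fin N) ℂ) :
    ∃ c : ℝ≥0∞, ∀ A : Set (ι → G), Measure.pi (fun _ : ι => haarProbability G) A =
      c * μH[(Fintype.card (ι × Fin (dimE ρ)) : ℝ)] (ρ.compLeft ι '' A) := by
  have hD : (0 : ℝ) ≤ (Fintype.card (ι × Fin (dimE ρ)) : ℝ) := Nat.cast_nonneg _
  haveI : BorelSpace (ι → Matrix (Fin N) (Fin N) ℂ) := hB
  have hemb : Topology.IsClosedEmbedding ρ := hρ.isClosedEmbedding hinj
  haveI : SecondCountableTopology G := hemb.isEmbedding.secondCountableTopology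
  haveI : (haarProbability G).IsHaarMeasure := by unfold haarProbability; infer_instance
  have hθ : MeasurableEmbedding (ρ.compLeft ι) :=
    ((continuous_compLeft ρ hρ).isClosedEmbedding (compLeft_injective ρ hinj)).measurableEmbedding
  set ν : Measure (ι → G) :=
    Measure.comap (ρ.compLeft ι) μH[(Fintype.card (ι × Fin (dimE ρ)) : ℝ)]
  have hνA : ∀ A, ν A = μH[(Fintype.card (ι × Fin (dimE ρ)) : ℝ)] (ρ.compLeft ι '' A) :=
    fun A => hθ.comap_apply _ A
  haveI : ν.IsMulLeftInvariant := ⟨fun u => Measure.ext fun A hA => by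
    rw [Measure.map_apply (measurable_const_mul u) hA, hνA, hνA,
      hausdorffMeasure_compLeft_preimage_mul ρ hU hD]⟩
  have hfin : ν univ < ∞ := by
    rw [hνA, image_univ]
    exact hausdorffMeasure_range_compLeft_lt_top ρ hρ hinj hU
  have hpos : ν univ ≠ 0 := by
    rw [hνA, image_univ]
    exact hausdorffMeasure_range_compLeft_ne_zero ρ hρ
  haveI : IsFiniteMeasureOnCompacts ν := ⟨fun K _ => (measure_mono (subset_univ K)).trans_lt hfin⟩
  have huniq := Measure.isMulInvariant_eq_smul_of_compactSpace ν
    (Measure.pi fun _ : ι => haarProbability G)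
  set c := ν.haarScalarFactor (Measure.pi fun _ : ι => haarProbability G)
  have hc0 : c ≠ 0 := by
    intro h0
    rw [h0, zero_smul] at huniq
    exact hpos (by simp [huniq])
  refine ⟨(c : ℝ≥0∞)⁻¹, fun A => ?_⟩
  have hA : ν A = c * Measure.pi (fun _ : ι => haarProbability G) A := by
    rw [huniq, Measure.coe_nnreal_smul_apply]
  rw [← hνA, hA, ← mul_assoc, ENNReal.inv_mul_cancel (ENNReal.coe_ne_zero.2 hc0) ENNReal.coe_ne_top,
    one_mul]

end Haar

end HaarCoLipschitz

/-! ## The registered stub -/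

open HaarCoLipschitz in
/-- **Haar measure scales under co-Lipschitz maps like a `D`-dimensional Hausdorff measure**
(`stub_haarCoLipschitz` of line `Sketch`).  For a compact group `G` with a faithful continuous
unitary representation `ρ : G →* M_N(ℂ)` and a finite index type `ι` there are `D ≥ 0`
(`= #ι · dim 𝔤_ρ`) and `C` (`= 1`) such that: whenever `F` maps a measurable `X ⊆ G^ι` into a
measurable `Y` and is co-Lipschitz on `X` by the factor `K` in the sup-of-Frobenius distance of the
matrix image, then `Haar^ι(X) ≤ C · K^D · Haar^ι(Y)`. -/
theorem stub_haarCoLipschitz :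
    ∀ (G : Type) [Group G] [TopologicalSpace G] [IsTopologicalGroup G] [CompactSpace G] [MeasurableSpace G] [BorelSpace G]
      (N : ℕ) (ρ : G →* Matrix (Fin N) (Fin N) ℂ), Continuous ρ → Function.Injective ρ →
      (∀ g, ρ g ∈ Matrix.unitaryGroup (Fin N) ℂ) →
      ∀ (ι : Type) [Fintype ι], ∃ (D : ℝ) (C : ℝ≥0), 0 ≤ D ∧
        ∀ (K : ℝ≥0) (X Y : Set (ι → G)), MeasurableSet X → MeasurableSet Y →
          ∀ F : (ι → G) → (ι → G), Set.MapsTo F X Y →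
            (∀ u ∈ X, ∀ v ∈ X, ‖(fun e => ρ (u e) - ρ (v e))‖ ≤ K * ‖(fun e => ρ (F u e) - ρ (F v e))‖) →
            Measure.pi (fun _ : ι => haarProbability G) X ≤
              (C : ℝ≥0∞) * (K : ℝ≥0∞) ^ D * Measure.pi (fun _ : ι => haarProbability G) Y := by
  intro G _ _ _ _ _ _ N ρ hρ hinj hU ι _
  letI mM : MeasurableSpace (ι → Matrix (Fin N) (Fin N) ℂ) := borel _
  haveI hB₀ : BorelSpace (ι → Matrix (Fin N) (Fin N) ℂ) := ⟨rfl⟩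
  haveI : @BorelSpace (ι → Matrix (Fin N) (Fin N) ℂ) (UniformSpace.toTopologicalSpace
      (self := PseudoEMetricSpace.toUniformSpace (self := EMetricSpace.toPseudoEMetricSpace))) mM := hB₀
  obtain ⟨c, hc⟩ := exists_pi_haar_eq_mul_hausdorffMeasure ρ hρ hinj hU (ι := ι)
  refine ⟨(Fintype.card (ι × Fin (dimE ρ)) : ℝ), 1, Nat.cast_nonneg _, ?_⟩
  intro K X Y _ _ F hF hco
  rw [hc X, hc Y]
  calc c * μH[(Fintype.card (ι × Fin (dimE ρ)) : ℝ)] (ρ.compLeft ι '' X)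
      ≤ c * ((K : ℝ≥0∞) ^ (Fintype.card (ι × Fin (dimE ρ)) : ℝ) *
          μH[(Fintype.card (ι × Fin (dimE ρ)) : ℝ)] (ρ.compLeft ι '' Y)) := by
        gcongr
        exact hausdorffMeasure_compLeft_le_of_coLipschitz ρ hinj (Nat.cast_nonneg _) hF hco
    _ = ((1 : ℝ≥0) : ℝ≥0∞) * (K : ℝ≥0∞) ^ (Fintype.card (ι × Fin (dimE ρ)) : ℝ) *
          (c * μH[(Fintype.card (ι × Fin (dimE ρ)) : ℝ)] (ρ.compLeft ι '' Y)) := by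
        rw [ENNReal.coe_one, one_mul, mul_left_comm]

end Summit.QuantumFields.YangMills.Theorems.FemtoCurvatureTwoPointC

end
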